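import Literature.NumberTheory.GaloisRepresentations.LocalReciprocityNormFunctoriality
import Literature.NumberTheory.GaloisRepresentations.LocalWeilDatumExtensionInsep
import HarnessLib

/-!
# Norm functoriality of the local reciprocity map (Serre XIII §4 Prop. 10) for arbitrary finite `E/F`

`LocalReciprocityNormFunctoriality.lean` proves the pair fact
`exists_isReciprocitySystem_normCompatible F E` for `E/F` finite **separable**.  This file removes
the separability hypothesis (so it also covers the inseparable extensions of local fields of
characteristic `p`) and concludes the unconditional discharges

* `exists_isReciprocitySystem_normCompatible_holds F E`,
* `exists_isLocalReciprocityMap_normCompatible_holds F E`,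
* **`exists_isCompatible_holds F : exists_isCompatible F`** (`LocalClassFieldTheory.lean`, Serre XIII §4
  Prop. 10: local Artin data of `F` and of every finite `E/F` compatible with the norm).

The reciprocity system of `E` is again read inside the Weil datum of `F` on the field
`U_E = W_F ∩ G_{E₀} = W_F ∩ G_{E₀s}` (`E₀ = ι⁻¹E`, `E₀s = E₀ ∩ F^sep`,
`LocalWeilDatumExtensionInsep`), but `x ∈ Eˣ` is now sent to `(ι⁻¹x)^q ∈ E₀sˣ = A^{U_E}`,
`q = [E₀ : E₀s]` the inseparable degree (the relative Frobenius, a field isomorphism `E₀ ≅ E₀s` for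
local fields, `[F : F^p] = p`): `N_{E₀s/F}((ι⁻¹x)^q) = N_{E/F}(x)`, `v_{U_E}((ι⁻¹x)^q) = ord_E(x)`,
and the norm groups correspond along the Frobenius-twisted isomorphism of pairs
`(E ⊆ L') ≅ (E₀s ⊆ (ι⁻¹L')_s)`.  The finite abelian layer of `E` dominating a given `L/F` is
produced by `exists_isAbelianGalois_fixingSubgroup_eq` (no compositum algebra).

## References

* J.-P. Serre, *Local Fields*, Ch. XIII §4, Prop. 10; Ch. II §4. [SerreLocalFields1979]
* J. Neukirch, *Algebraic Number Theory*, Ch. IV §5 (5.8), §6 (6.4)–(6.6); Ch. V §1 (1.4). [NeukirchANT1999]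
-/

noncomputable section

open Field IsNonarchimedeanLocalField ValuativeRel
open scoped Pointwise Valued

namespace Literature.NumberTheory.GaloisRepresentations

namespace LocalWeilDatum

open AbstractCFT AbstractCFT.WeilDatum GaloisRepresentations.IsNonarchimedeanLocalField

/-! ### Separable parts of finite subextensions of `F̄` -/

section SepLift

variable (F : Type*) [Field F]

/-- The separable part `K ∩ F^sep` of `K ⊆ F̄`, as a subfield of `F̄`. [folklore] -/
abbrev sepLift (K : IntermediateField F (AlgebraicClosure F)) : IntermediateField F (AlgebraicClosure F) :=
  IntermediateField.lift (separableClosure F K)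

/-- Membership in the separable part. [folklore] -/
theorem mem_sepLift_iff {K : IntermediateField F (AlgebraicClosure F)} {a : AlgebraicClosure F} :
    a ∈ sepLift F K ↔ a ∈ K ∧ IsSeparable F a := by
  constructor
  · rintro ⟨z, hz, rfl⟩
    exact ⟨z.2, (mem_separableClosure_iff.mp hz).map K.val Subtype.val_injective⟩
  · rintro ⟨ha, hs⟩
    refine ⟨⟨a, ha⟩, ?_, rfl⟩
    change (⟨a, ha⟩ : K) ∈ separableClosure F K
    rw [mem_separableClosure_iff]
    exact (isSeparable_map_iff K.val Subtype.val_injective).mp hs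

/-- `K ∩ F^sep ≤ K`. [folklore] -/
theorem sepLift_le (K : IntermediateField F (AlgebraicClosure F)) : sepLift F K ≤ K :=
  IntermediateField.lift_le _

/-- `K ∩ F^sep ⊆ F^sep`. [folklore] -/
theorem sepLift_le_sepClosure (K : IntermediateField F (AlgebraicClosure F)) : sepLift F K ≤ sepClosure F :=
  fun _ ha => mem_separableClosure_iff.mpr ((mem_sepLift_iff F).mp ha).2

/-- Monotonicity of the separable part. [folklore] -/
theorem sepLift_mono {K K' : IntermediateField F (AlgebraicClosure F)} (h : K ≤ K') : sepLift F K ≤ sepLift F K' :=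
  fun _ ha => (mem_sepLift_iff F).mpr ⟨h ((mem_sepLift_iff F).mp ha).1, ((mem_sepLift_iff F).mp ha).2⟩

/-- The separable part of a finite `K` is finite. [folklore] -/
theorem finiteDimensional_sepLift (K : IntermediateField F (AlgebraicClosure F)) [FiniteDimensional F K] :
    FiniteDimensional F (sepLift F K) :=
  LinearEquiv.finiteDimensional (IntermediateField.liftAlgEquiv (separableClosure F K)).toLinearEquiv

/-- **`Gal(F̄/(K ∩ F^sep)) = Gal(F̄/K)`** (`K/(K ∩ F^sep)` purely inseparable). [cite: MilneFT2022, Ch. 3] -/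
theorem galFixing_sepLift_eq (K : IntermediateField F (AlgebraicClosure F)) : galFixing F (sepLift F K) = galFixing F K := by
  refine le_antisymm (fun σ hσ => ?_) (galFixing_antitone F (sepLift_le F K))
  rw [mem_galFixing_iff]
  intro a ha
  rw [absoluteGaloisGroup.smul_def]
  refine apply_eq_self_of_forall_mem_separableClosure K (absoluteGaloisGroup.toAlgEquiv F σ) (fun y hy => ?_) a ha
  rw [← absoluteGaloisGroup.smul_def]
  exact (mem_galFixing_iff F).mp hσ y hy

/-! Throughout, the inseparable degree `[K : K ∩ F^sep]` of a finite `K ⊆ F̄` is Mathlib's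
`Field.finInsepDegree F K` (a power of the exponential characteristic, `finInsepDegree_eq_pow`). -/

/-- `ringExpChar F ^ log (finInsepDegree) = finInsepDegree`. [folklore] -/
theorem pow_log_finInsepDegree (K : IntermediateField F (AlgebraicClosure F)) [FiniteDimensional F K] :
    ringExpChar F ^ Nat.log (ringExpChar F) (Field.finInsepDegree F K) = Field.finInsepDegree F K := by
  obtain ⟨m, hm⟩ := finInsepDegree_eq_pow F K (ringExpChar F)
  obtain ⟨p, hp⟩ := ExpChar.exists F
  have hpe : ringExpChar F = p := ringExpChar.eq F p
  rw [hm, hpe]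
  rcases hp with _ | ⟨hp⟩
  · rw [one_pow, one_pow]
  · rw [Nat.log_pow hp.one_lt]

/-- `z^q ∈ K ∩ F^sep` for `z ∈ K`, `q = [K : K ∩ F^sep]`. [folklore] -/
theorem pow_finInsepDegree_mem_sepLift {K : IntermediateField F (AlgebraicClosure F)} [FiniteDimensional F K] (z : K) :
    (z : AlgebraicClosure F) ^ Field.finInsepDegree F K ∈ sepLift F K := by
  have h := IsPurelyInseparable.algebraMap_iterateFrobenius (separableClosure F K) (ringExpChar F)
    (IsPurelyInseparable.exponent_le_log_finrank (separableClosure F K) K (ringExpChar F)) z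
  have h' : ((IsPurelyInseparable.iterateFrobenius (separableClosure F K) K (ringExpChar F)
      (IsPurelyInseparable.exponent_le_log_finrank (separableClosure F K) K (ringExpChar F)) z :
        separableClosure F K) : K) = z ^ Field.finInsepDegree F K := by
    rw [← pow_log_finInsepDegree F K]
    exact h
  have hmem := (IntermediateField.mem_lift (E := separableClosure F K) _).mpr
    (IsPurelyInseparable.iterateFrobenius (separableClosure F K) K (ringExpChar F)
      (IsPurelyInseparable.exponent_le_log_finrank (separableClosure F K) K (ringExpChar F)) z).2
  rw [h'] at hmem
  simpa using hmem

/-- `(a + b)^q = a^q + b^q` for `q = finInsepDegree K`. [folklore] -/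
theorem add_pow_finInsepDegree (K : IntermediateField F (AlgebraicClosure F)) [FiniteDimensional F K]
    (a b : AlgebraicClosure F) : (a + b) ^ Field.finInsepDegree F K = a ^ Field.finInsepDegree F K + b ^ Field.finInsepDegree F K := by
  obtain ⟨m, hm⟩ := finInsepDegree_eq_pow F K (ringExpChar F)
  obtain ⟨p, hp⟩ := ExpChar.exists F
  haveI := hp
  have hpe : ringExpChar F = p := ringExpChar.eq F p
  haveI : ExpChar (AlgebraicClosure F) p :=
    expChar_of_injective_algebraMap (algebraMap F (AlgebraicClosure F)).injective _
  rw [hm, hpe, add_pow_expChar_pow]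

/-- `a ↦ a^q` is injective on `F̄` for `q = finInsepDegree K`. [folklore] -/
theorem pow_finInsepDegree_injective (K : IntermediateField F (AlgebraicClosure F)) [FiniteDimensional F K] :
    Function.Injective fun a : AlgebraicClosure F => a ^ Field.finInsepDegree F K := fun a b h => by
  obtain ⟨m, hm⟩ := finInsepDegree_eq_pow F K (ringExpChar F)
  obtain ⟨p, hp⟩ := ExpChar.exists F
  haveI := hp
  have hpe : ringExpChar F = p := ringExpChar.eq F p
  haveI : ExpChar (AlgebraicClosure F) p :=
    expChar_of_injective_algebraMap (algebraMap F (AlgebraicClosure F)).injective _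
  simp only [hm, hpe] at h
  exact iterateFrobenius_inj (AlgebraicClosure F) p m (by simpa [iterateFrobenius_def] using h)

end SepLift

section SepLiftLocal

variable (F : Type*) [Field F] [ValuativeRel F] [TopologicalSpace F] [IsNonarchimedeanLocalField F]

/-- `W_F ∩ G_{K ∩ F^sep} = W_F ∩ G_K`. [folklore] -/
theorem fieldSubgroup_sepLift_eq (K : IntermediateField F (AlgebraicClosure F)) :
    fieldSubgroup F (sepLift F K) = fieldSubgroup F K := by
  ext w
  rw [← toAbsGalois_mem_galFixing_iff, ← toAbsGalois_mem_galFixing_iff, galFixing_sepLift_eq]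

/-- **`W_F ∩ G_K` is a field of the Weil datum of `F` for every finite `K ⊆ F̄`** (separable or not).
[cite: NeukirchANT1999, Ch. IV §4] -/
theorem isFieldSubgroup_fieldSubgroup_of_finite (K : IntermediateField F (AlgebraicClosure F)) [FiniteDimensional F K] :
    IsFieldSubgroup F (fieldSubgroup F K) :=
  ⟨sepLift F K, finiteDimensional_sepLift F K, sepLift_le_sepClosure F K, (fieldSubgroup_sepLift_eq F K).symm⟩

/-- **The relative Frobenius `K → K ∩ F^sep`, `z ↦ z^q`, is onto** for `K` finite over the local field `F`
(`IsNonarchimedeanLocalField.iterateFrobenius_surjective`). [cite: SerreLocalFields1979, Ch. II §4] -/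
theorem exists_pow_finInsepDegree_eq {K : IntermediateField F (AlgebraicClosure F)} [FiniteDimensional F K]
    {a : AlgebraicClosure F} (ha : a ∈ sepLift F K) : ∃ z : K, (z : AlgebraicClosure F) ^ Field.finInsepDegree F K = a := by
  obtain ⟨s, hs, rfl⟩ := ha
  obtain ⟨z, hz⟩ := iterateFrobenius_surjective (ringExpChar F) K (separableClosure F K) ⟨s, hs⟩
  refine ⟨z, ?_⟩
  have h := IsPurelyInseparable.algebraMap_iterateFrobenius (separableClosure F K) (ringExpChar F)
    (IsPurelyInseparable.exponent_le_log_finrank (separableClosure F K) K (ringExpChar F)) z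
  rw [hz] at h
  change (algebraMap (separableClosure F K) K) ⟨s, hs⟩ = z ^ ringExpChar F ^ Nat.log (ringExpChar F) (Field.finInsepDegree F K) at h
  rw [pow_log_finInsepDegree] at h
  have := congrArg (fun u : K => (u : AlgebraicClosure F)) h
  simpa using this.symm

end SepLiftLocal

/-! ### The inseparable degree along a separable extension `L'/E` -/

section InsepDegree

variable (F E : Type*) [Field F] [Field E] [Algebra F E] [FiniteDimensional F E]

/-- **The inseparable degree does not change along a separable extension**: for `L'/E` finite
separable, `[ι⁻¹L' : (ι⁻¹L')_s] = [E₀ : E₀s]` (multiplicativity of the separable degree).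
[cite: MilneFT2022, Ch. 3] -/
theorem finInsepDegree_embFieldOf_eq (L' : IntermediateField E (AlgebraicClosure E)) [FiniteDimensional E L']
    [Algebra.IsSeparable E L'] : Field.finInsepDegree F (embFieldOf F E L') = insepDeg F E := by
  haveI := finiteDimensional_embField F E
  haveI := finiteDimensional_embFieldOf F E L'
  have hKL := embField_le_embFieldOf F E L'
  letI := towerAlgebra hKL
  haveI := towerAlgebra_isScalarTower_bot hKL
  haveI := towerAlgebra_finiteDimensional hKL
  -- `ι⁻¹L' / E₀` is separable (isomorphic to `L'/E`)
  haveI : Algebra.IsSeparable (embField F E) (embFieldOf F E L') := by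
    let e₁ : E ≃+* embField F E := (equivEmbField F E).toRingEquiv
    let e₂ : L' ≃+* embFieldOf F E L' :=
      { toFun := fun y => ⟨(absClosureEquiv F E).symm y, symm_mem_embFieldOf F E y.2⟩
        invFun := fun a => ⟨absClosureEmbedding F E a, a.2⟩
        left_inv := fun y => Subtype.ext (absClosureEmbedding_absClosureEquiv_symm F E _)
        right_inv := fun a => Subtype.ext (absClosureEquiv_symm_absClosureEmbedding F E _)
        map_mul' := fun a b => Subtype.ext (by simp)
        map_add' := fun a b => Subtype.ext (by simp) }
    refine Algebra.IsSeparable.of_equiv_equiv e₁ e₂ ?_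
    ext y
    apply (absClosureEmbedding_bijective F E).1
    change absClosureEmbedding F E ((equivEmbField F E y : embField F E) : AlgebraicClosure F) =
      absClosureEmbedding F E ((absClosureEquiv F E).symm (algebraMap E (AlgebraicClosure E) y))
    rw [absClosureEmbedding_equivEmbField, absClosureEmbedding_absClosureEquiv_symm]
  -- degrees
  have h1 := Field.finSepDegree_mul_finInsepDegree F (embFieldOf F E L')
  have h2 := Field.finSepDegree_mul_finInsepDegree F (embField F E)
  have h3 := Field.finSepDegree_mul_finSepDegree_of_isAlgebraic F (embField F E) (embFieldOf F E L')
  have h4 : Field.finSepDegree (embField F E) (embFieldOf F E L') = Module.finrank (embField F E) (embFieldOf F E L') :=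
    finSepDegree_eq_finrank_of_isSeparable _ _
  have h5 := Module.finrank_mul_finrank F (embField F E) (embFieldOf F E L')
  have hpos : 0 < Module.finrank (embField F E) (embFieldOf F E L') := Module.finrank_pos
  have hs0 : Field.finSepDegree F (embField F E) ≠ 0 := by
    intro h0
    rw [h0, zero_mul] at h2
    exact Module.finrank_pos.ne' h2.symm
  change Field.finInsepDegree F (embFieldOf F E L') = Field.finInsepDegree F (embField F E)
  have key : Field.finSepDegree F (embField F E) * Module.finrank (embField F E) (embFieldOf F E L') *
      Field.finInsepDegree F (embFieldOf F E L') =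
        Field.finSepDegree F (embField F E) * Module.finrank (embField F E) (embFieldOf F E L') *
          Field.finInsepDegree F (embField F E) := by
    calc _ = Module.finrank F (embFieldOf F E L') := by rw [← h4, h3, h1]
      _ = Module.finrank F (embField F E) * Module.finrank (embField F E) (embFieldOf F E L') := h5.symm
      _ = _ := by rw [← h2]; ring
  exact mul_left_cancel₀ (mul_ne_zero hs0 hpos.ne') key

end InsepDegree

/-! ### `Eˣ` inside `A^{U_E}` through the relative Frobenius -/

section PairI

variable (F E : Type*) [Field F] [ValuativeRel F] [TopologicalSpace F] [IsNonarchimedeanLocalField F]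
  [Field E] [Algebra F E] [FiniteDimensional F E]

/-- The element of `(F^sep)ˣ` attached to `x ∈ Eˣ`: the unit `(ι⁻¹x)^q ∈ E₀s ⊆ F^sep`,
`q = [E₀ : E₀s]`. [cite: NeukirchANT1999, Ch. V §1 (`A_K = K^*`); SerreLocalFields1979, Ch. II §4] -/
def unitI (x : Eˣ) : SepUnits F :=
  haveI := finiteDimensional_embSepField F E
  ((unitsEquivFixedBy F (embSepField_le_sepClosure F E)
    (Units.map ((powEmb F E).comp ((equivEmbField F E : E ≃ₐ[F] embField F E) : E →* embField F E)) x) :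
      fixedBy (SepUnits F) (fieldSubgroup F (embSepField F E))) : SepUnits F)

/-- `unitI x ∈ A^{U_E}`. [folklore] -/
theorem unitI_mem (x : Eˣ) : unitI F E x ∈ fixedBy (SepUnits F) (fieldSubgroup F (embField F E)) := by
  haveI := finiteDimensional_embSepField F E
  rw [← fieldSubgroup_embSepField_eq]
  exact (unitsEquivFixedBy F (embSepField_le_sepClosure F E) _).2

/-- `unitI x` is `(ι⁻¹ x)^q` in `F̄`. [folklore] -/
theorem coe_unitI (x : Eˣ) :
    (((unitI F E x : SepUnits F) : SepClosure F) : AlgebraicClosure F) =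
      ((equivEmbField F E (x : E) : embField F E) : AlgebraicClosure F) ^ insepDeg F E :=
  rfl

/-- The element of `E₀s` underlying `unitI x` is `powEmb (e x)`. [folklore] -/
theorem coe_unitI_mem (x : Eˣ) :
    (((unitI F E x : SepUnits F) : SepClosure F) : AlgebraicClosure F) ∈ embSepField F E :=
  (powEmb F E (equivEmbField F E (x : E))).2

/-- `unitI` is multiplicative. [folklore] -/
theorem unitI_mul (x y : Eˣ) : unitI F E (x * y) = unitI F E x * unitI F E y := by
  unfold unitI
  rw [map_mul, map_mul]
  rfl

/-- `unitI 1 = 1`. [folklore] -/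
theorem unitI_one : unitI F E 1 = 1 := by
  unfold unitI
  rw [map_one, map_one]
  rfl

/-- Every element of `A^{U_E}` is `unitI x`. [cite: NeukirchANT1999, Ch. V §1 (`A_K = K^*`)] -/
theorem exists_unitI_eq_of_mem_fixedBy {a : SepUnits F} (ha : a ∈ fixedBy (SepUnits F) (fieldSubgroup F (embField F E))) :
    ∃ x : Eˣ, unitI F E x = a := by
  haveI := finiteDimensional_embSepField F E
  rw [← fieldSubgroup_embSepField_eq] at ha
  set x₀ := (unitsEquivFixedBy F (embSepField_le_sepClosure F E)).symm ⟨a, ha⟩ with hx₀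
  -- `x₀ = powEmb z` for a unit `z` of `E₀`
  obtain ⟨z, hz⟩ := powEmb_surjective F E (x₀ : embSepField F E)
  have hz0 : z ≠ 0 := by
    rintro rfl
    have : ((x₀ : (embSepField F E)ˣ) : embSepField F E) = 0 := by
      rw [← hz]; exact Subtype.ext (by simp [zero_pow (insepDeg_pos F E).ne'])
    exact x₀.ne_zero this
  refine ⟨Units.map ((equivEmbField F E).symm : embField F E →* E) (Units.mk0 z hz0), ?_⟩
  unfold unitI
  have : Units.map ((powEmb F E).comp ((equivEmbField F E : E ≃ₐ[F] embField F E) : E →* embField F E))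
      (Units.map ((equivEmbField F E).symm : embField F E →* E) (Units.mk0 z hz0)) = x₀ := by
    ext
    simp [hz]
  rw [this, hx₀, MulEquiv.apply_symm_apply]

/-! ### The abelian pair `(U_E, W_F ∩ G_{ι⁻¹ L'})` -/

/-- `U_E = W_F ∩ G_{E₀}` is a field of the datum (every finite `E/F`). [folklore] -/
theorem isField_fieldSubgroup_embField_of_finite : (localWeilDatum F).IsField (fieldSubgroup F (embField F E)) := by
  haveI := finiteDimensional_embField F E
  exact isFieldSubgroup_fieldSubgroup_of_finite F (embField F E)

/-- `W_F ∩ G_{ι⁻¹ L'}` is a field of the datum, for `L'/E` finite. [folklore] -/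
theorem isField_fieldSubgroup_embFieldOf_of_finite (L' : IntermediateField E (AlgebraicClosure E)) [FiniteDimensional E L'] :
    (localWeilDatum F).IsField (fieldSubgroup F (embFieldOf F E L')) := by
  haveI := finiteDimensional_embFieldOf F E L'
  exact isFieldSubgroup_fieldSubgroup_of_finite F (embFieldOf F E L')

/-- **`(U_E, W_F ∩ G_{ι⁻¹L'})` is an abelian pair** of the Weil datum of `F`, for `L'/E` finite abelian
(every finite `E/F`). [cite: NeukirchANT1999, Ch. IV §6, (6.4)] -/
theorem isAbelianPair_embField_of_finite (L' : IntermediateField E (AlgebraicClosure E)) [FiniteDimensional E L']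
    [IsAbelianGalois E L'] :
    (localWeilDatum F).IsAbelianPair (fieldSubgroup F (embField F E)) (fieldSubgroup F (embFieldOf F E L')) where
  isField_left := isField_fieldSubgroup_embField_of_finite F E
  isField_right := isField_fieldSubgroup_embFieldOf_of_finite F E L'
  le := fieldSubgroup_antitone F (embField_le_embFieldOf F E L')
  commutator_mem := fun _ ha _ hb => commutator_mem_fieldSubgroup_embFieldOf F E L' ha hb

variable {F E}

/-! ### The reciprocity system of `E` read in the datum of `F` -/

/-- **The norm residue symbols of `E` from the Weil datum of `F`** (every finite `E/F`): for `L'/E`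
finite abelian, `x ↦ (x, L'/E) := ν|_{L'}` where `ν ∈ U_E` is the norm residue representative of
`(ι⁻¹ x)^q ∈ A^{U_E}` for the abelian pair `(U_E, W_F ∩ G_{ι⁻¹L'})`; trivial on non-(finite abelian) `L'`.
[cite: NeukirchANT1999, Ch. IV §6, (6.4)–(6.5); SerreLocalFields1979, Ch. XIII §4] -/
def recSystemI (hcf : (localWeilDatum F).IsClassFieldTheory) (L' : IntermediateField E (AlgebraicClosure E)) :
    Eˣ →* (L' ≃ₐ[E] L') := by
  classical
  exact if h : FiniteDimensional E L' ∧ IsAbelianGalois E L' then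
    haveI := h.1
    haveI := h.2
    { toFun := fun x => weilRestrictE F E L'
        ⟨hcf.normResidue (isAbelianPair_embField_of_finite F E L') (unitI_mem F E x), hcf.normResidue_mem _ _⟩
      map_one' := by
        rw [weilRestrictE_eq_one_iff]
        change hcf.normResidue (isAbelianPair_embField_of_finite F E L') (unitI_mem F E 1) ∈ _
        rw [hcf.normResidue_mem_iff]
        rw [unitI_one]
        exact (normGroup _ _).one_mem
      map_mul' := fun x y => by
        have key : ∀ {a b : SepUnits F} (ha : a ∈ fixedBy (SepUnits F) (fieldSubgroup F (embField F E)))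
            (hb : b ∈ fixedBy (SepUnits F) (fieldSubgroup F (embField F E))), a = b →
            hcf.normResidue (isAbelianPair_embField_of_finite F E L') ha =
              hcf.normResidue (isAbelianPair_embField_of_finite F E L') hb := by
          rintro a b ha hb rfl
          rfl
        rw [← map_mul, weilRestrictE_eq_iff]
        change (hcf.normResidue (isAbelianPair_embField_of_finite F E L') (unitI_mem F E (x * y)))⁻¹ *
          (hcf.normResidue (isAbelianPair_embField_of_finite F E L') (unitI_mem F E x) *
            hcf.normResidue (isAbelianPair_embField_of_finite F E L') (unitI_mem F E y)) ∈ _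
        rw [key (unitI_mem F E (x * y)) ((fixedBy (SepUnits F) _).mul_mem (unitI_mem F E x) (unitI_mem F E y))
          (unitI_mul F E x y)]
        exact hcf.normResidue_mul_inv_mul_mem (isAbelianPair_embField_of_finite F E L') (unitI_mem F E x) (unitI_mem F E y) }
  else 1

/-- Unfolding `recSystemI` at a finite abelian level. [folklore] -/
theorem recSystemI_apply (hcf : (localWeilDatum F).IsClassFieldTheory) (L' : IntermediateField E (AlgebraicClosure E))
    [FiniteDimensional E L'] [IsAbelianGalois E L'] (x : Eˣ) :
    recSystemI hcf L' x = weilRestrictE F E L'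
      ⟨hcf.normResidue (isAbelianPair_embField_of_finite F E L') (unitI_mem F E x), hcf.normResidue_mem _ _⟩ := by
  rw [recSystemI, dif_pos ⟨‹_›, ‹_›⟩]
  rfl

/-- **Defining property**: `(x, L'/E) = w|_{L'} ↔ r_{U_E, V'}(w) ≡ (ι⁻¹x)^q mod N` (`w ∈ U_E`).
[cite: NeukirchANT1999, Ch. IV §6, after Thm. (6.3)] -/
theorem recSystemI_eq_weilRestrictE_iff (hcf : (localWeilDatum F).IsClassFieldTheory)
    (L' : IntermediateField E (AlgebraicClosure E)) [FiniteDimensional E L'] [IsAbelianGalois E L']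
    (x : Eˣ) (w : fieldSubgroup F (embField F E)) :
    recSystemI hcf L' x = weilRestrictE F E L' w ↔
      (localWeilDatum F).recMap (fieldSubgroup F (embField F E)) (fieldSubgroup F (embFieldOf F E L')) w =
        QuotientGroup.mk (unitI F E x) := by
  rw [recSystemI_apply, weilRestrictE_eq_iff]
  exact hcf.normResidue_inv_mul_mem_iff (isAbelianPair_embField_of_finite F E L') (unitI_mem F E x) w.2

/-! ### The norm-group dictionary along the Frobenius-twisted isomorphism of pairs -/

/-- **`(ι⁻¹x)^q ∈ N_{V'|U_E} A^{V'} ↔ x ∈ N_{L'/E} L'ˣ`**: the pair `(E ⊆ L')` is isomorphic to the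
separable pair `(E₀s ⊆ (ι⁻¹L')_s)` through `y ↦ (ι⁻¹y)^q` (same `q`, `finInsepDegree_embFieldOf_eq`), and
for the latter the relative dictionary of `LocalWeilDatumRelative` applies.
[cite: NeukirchANT1999, Ch. IV §6, (6.4); Ch. V §1; SerreLocalFields1979, Ch. II §4] -/
theorem unitI_mem_normGroup_iff (L' : IntermediateField E (AlgebraicClosure E)) [FiniteDimensional E L']
    [Algebra.IsSeparable E L'] (x : Eˣ) :
    unitI F E x ∈ normGroup (fieldSubgroup F (embFieldOf F E L')) (fieldSubgroup F (embField F E)) ↔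
      x ∈ (Units.map (Algebra.norm E : L' →* E)).range := by
  haveI := finiteDimensional_embField F E
  haveI := finiteDimensional_embFieldOf F E L'
  haveI := finiteDimensional_embSepField F E
  haveI : FiniteDimensional F (sepLift F (embFieldOf F E L')) := finiteDimensional_sepLift F _
  have hq : Field.finInsepDegree F (embFieldOf F E L') = insepDeg F E := finInsepDegree_embFieldOf_eq F E L'
  -- the separable pair `Ks ≤ Ls`
  have hKL : embSepField F E ≤ sepLift F (embFieldOf F E L') := sepLift_mono F (embField_le_embFieldOf F E L')
  have hKs := embSepField_le_sepClosure F E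
  have hLs := sepLift_le_sepClosure F (embFieldOf F E L')
  letI := towerAlgebra hKL
  -- the Frobenius-twisted isomorphism of pairs `(E ⊆ L') ≅ (Ks ⊆ Ls)`
  let f₁ : E →+* embSepField F E := (powEmbRingHom F E).comp (equivEmbField F E : E ≃ₐ[F] embField F E).toRingHom
  have hf₁ : Function.Bijective f₁ :=
    ⟨(powEmb_injective F E).comp (equivEmbField F E).injective,
      (powEmb_surjective F E).comp (equivEmbField F E).surjective⟩
  let e₁ : E ≃+* embSepField F E := RingEquiv.ofBijective f₁ hf₁
  have he₁ : ∀ y : E, ((e₁ y : embSepField F E) : AlgebraicClosure F) =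
      ((equivEmbField F E y : embField F E) : AlgebraicClosure F) ^ insepDeg F E := fun y => rfl
  have hadd : ∀ a b : AlgebraicClosure F, (a + b) ^ insepDeg F E = a ^ insepDeg F E + b ^ insepDeg F E := by
    rw [← hq]
    exact add_pow_finInsepDegree F _
  let f₂ : L' →+* sepLift F (embFieldOf F E L') :=
    { toFun := fun y => ⟨((absClosureEquiv F E).symm (y : AlgebraicClosure E)) ^ insepDeg F E, by
        rw [← hq]
        exact pow_finInsepDegree_mem_sepLift F (⟨_, symm_mem_embFieldOf F E y.2⟩ : embFieldOf F E L')⟩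
      map_one' := Subtype.ext (by simp)
      map_mul' := fun a b => Subtype.ext (by simp [mul_pow])
      map_zero' := Subtype.ext (by simp [zero_pow (insepDeg_pos F E).ne'])
      map_add' := fun a b => Subtype.ext (by
        change ((absClosureEquiv F E).symm ((a + b : L') : AlgebraicClosure E)) ^ insepDeg F E = _
        rw [AddMemClass.coe_add, map_add, hadd]
        rfl) }
  have hf₂v : ∀ y : L', ((f₂ y : sepLift F (embFieldOf F E L')) : AlgebraicClosure F) =
      ((absClosureEquiv F E).symm (y : AlgebraicClosure E)) ^ insepDeg F E := fun y => rfl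
  have hf₂ : Function.Bijective f₂ := by
    constructor
    · intro a b h
      have h' := congrArg (fun u : sepLift F (embFieldOf F E L') => (u : AlgebraicClosure F)) h
      simp only [hf₂v, ← hq] at h'
      have h'' := pow_finInsepDegree_injective F (embFieldOf F E L') h'
      exact Subtype.ext ((absClosureEquiv F E).symm.injective h'')
    · intro c
      obtain ⟨z, hz⟩ := exists_pow_finInsepDegree_eq F c.2
      refine ⟨⟨absClosureEmbedding F E z, z.2⟩, Subtype.ext ?_⟩
      rw [hf₂v]
      change ((absClosureEquiv F E).symm (absClosureEmbedding F E (z : AlgebraicClosure F))) ^ insepDeg F E = _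
      rw [absClosureEquiv_symm_absClosureEmbedding, ← hq, hz]
  let e₂ : L' ≃+* sepLift F (embFieldOf F E L') := RingEquiv.ofBijective f₂ hf₂
  have he : (algebraMap (embSepField F E) (sepLift F (embFieldOf F E L'))).comp (e₁ : E →+* embSepField F E) =
      (e₂ : L' →+* sepLift F (embFieldOf F E L')).comp (algebraMap E L') := by
    ext y
    change ((equivEmbField F E y : embField F E) : AlgebraicClosure F) ^ insepDeg F E =
      ((absClosureEquiv F E).symm ((algebraMap E L' y : L') : AlgebraicClosure E)) ^ insepDeg F E
    rfl
  have hnorm : ∀ y : L', Algebra.norm (embSepField F E) (e₂ y) = e₁ (Algebra.norm E y) := by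
    intro y
    have := Algebra.norm_eq_of_equiv_equiv e₁ e₂ he y
    rw [this, RingEquiv.apply_symm_apply]
  -- `unitI x` is the unit of `e₁ x`
  have hunit : unitI F E x = ((unitsEquivFixedBy F hKs (Units.map (e₁ : E →* embSepField F E) x) :
      fixedBy (SepUnits F) (fieldSubgroup F (embSepField F E))) : SepUnits F) :=
    Units.ext (Subtype.ext rfl)
  rw [hunit, ← fieldSubgroup_embSepField_eq, ← fieldSubgroup_sepLift_eq F (embFieldOf F E L'),
    unitsEquivFixedBy_mem_normGroup_iff F hKL hKs hLs]
  constructor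
  · rintro ⟨c, hc⟩
    have hval : Algebra.norm (embSepField F E) (c : sepLift F (embFieldOf F E L')) = e₁ (x : E) := by
      have := congrArg Units.val hc
      simpa [Units.coe_map] using this
    have hy0 : e₂.symm (c : sepLift F (embFieldOf F E L')) ≠ 0 :=
      (map_ne_zero_iff e₂.symm e₂.symm.injective).mpr c.ne_zero
    refine ⟨Units.mk0 _ hy0, Units.ext ?_⟩
    have h2 : e₁ (Algebra.norm E (e₂.symm (c : sepLift F (embFieldOf F E L')))) = e₁ (x : E) := by
      rw [← hnorm, RingEquiv.apply_symm_apply, hval]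
    simpa [Units.coe_map] using e₁.injective h2
  · rintro ⟨y, rfl⟩
    have hc0 : e₂ (y : L') ≠ 0 := (map_ne_zero_iff e₂ e₂.injective).mpr y.ne_zero
    refine ⟨Units.mk0 _ hc0, Units.ext ?_⟩
    simp only [Units.coe_map, MonoidHom.coe_coe, Units.val_mk0]
    rw [hnorm]

end PairI

/-! ### Dictionaries for `E`: valuation and units -/

section PairILocal

variable {F E : Type*} [Field F] [ValuativeRel F] [TopologicalSpace F] [IsNonarchimedeanLocalField F]
  [Field E] [ValuativeRel E] [TopologicalSpace E] [IsNonarchimedeanLocalField E]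
  [Algebra F E] [FiniteDimensional F E] [ValuativeExtension F E]

/-- **The valuation of the datum on `U_E`, at `(ι⁻¹ x)^q`, is `ord_E x`.**
[cite: NeukirchANT1999, Ch. V §1 (`v_K = (1/f_K) v ∘ N`); SerreLocalFields1979, Ch. II §4] -/
theorem val_unitI (x : Eˣ) :
    (localWeilDatum F).val (fieldSubgroup F (embField F E)) (unitI F E x) = ord E (x : E) := by
  haveI := finiteDimensional_embSepField F E
  set d := localWeilDatum F
  have hU := isField_fieldSubgroup_embField_of_finite F E
  have hKs := embSepField_le_sepClosure F E
  have h := d.val_eq hU (unitI_mem F E x)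
  have haK := coe_unitI_mem F E x
  have hv : d.v (norm (fieldSubgroup F (embField F E)) ⊤ (unitI F E x)) =
      (Ideal.inertiaDeg' 𝓂[F] (primeOf F (embSepField F E)) : ℤ) * ord E (x : E) := by
    rw [← fieldSubgroup_embSepField_eq]
    change vSep F _ = _
    rw [vSep_eq_ord F (norm_fieldSubgroup_top_eq_algebraMap F (embSepField F E) hKs haK).symm,
      show (⟨_, haK⟩ : embSepField F E) = powEmb F E (equivEmbField F E (x : E)) from rfl,
      ord_norm_powEmb F E x]
  have hfU : (d.f (fieldSubgroup F (embField F E)) : ℤ) = Ideal.inertiaDeg' 𝓂[F] (primeOf F (embSepField F E)) := by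
    change ((AbstractCFT.inertiaDeg (degHom F) (fieldSubgroup F (embField F E)) : ℕ) : ℤ) = _
    rw [← fieldSubgroup_embSepField_eq, inertiaDeg_fieldSubgroup_eq F (embSepField F E) hKs]
  have hf0 : (d.f (fieldSubgroup F (embField F E)) : ℤ) ≠ 0 := by exact_mod_cast (d.f_pos hU).ne'
  rw [hv, ← hfU] at h
  exact mul_left_cancel₀ hf0 h

/-- Units: `(ι⁻¹ u)^q ∈ U_{U_E}` iff `u ∈ 𝒪[E]ˣ`. [cite: NeukirchANT1999, Ch. V §1] -/
theorem unitI_mem_unitGroup_iff (u : Eˣ) :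
    unitI F E u ∈ (localWeilDatum F).unitGroup (fieldSubgroup F (embField F E)) ↔
      u ∈ (valuation E).valuationSubring.unitGroup := by
  rw [(localWeilDatum F).mem_unitGroup_iff (isField_fieldSubgroup_embField_of_finite F E), val_unitI,
    Valuation.mem_unitGroup_iff, ord_eq_zero_iff E u.ne_zero]
  exact ⟨fun h => h.2, fun h => ⟨unitI_mem F E u, h⟩⟩

/-! ### `recSystemI` is a reciprocity system of `E` -/

/-- **`recSystemI` is a reciprocity system of `E`, for every finite `E/F`** (all of Serre's
finite-level properties, read in the Weil datum of `F` through the relative Frobenius): surjectivity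
and kernel `N_{L'/E} L'ˣ` (6.3), compatibility (5.8), units onto inertia and `(ϖ, L'/E) = Frob` for
unramified `L'` ((5.7), (6.2)), through the dictionaries `v_{U_E}((ι⁻¹x)^q) = ord_E x`,
`I ∩ U_E ↔ I_E`, `q_E = q_F^{f(E₀s)}`, and the Frobenius-twisted norm-group dictionary.
[cite: NeukirchANT1999, Ch. IV §6, (6.3)–(6.5); Ch. V §1, Thm. (1.3), (1.4); SerreLocalFields1979, Ch. XIII §4] -/
theorem isReciprocitySystemI (hcf : (localWeilDatum F).IsClassFieldTheory) :
    IsReciprocitySystem E (recSystemI (F := F) (E := E) hcf) where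
  surjective L' _ _ := by
    intro g
    set d := localWeilDatum F
    have hab := isAbelianPair_embField_of_finite F E L'
    obtain ⟨w, rfl⟩ := weilRestrictE_surjective F E L' g
    obtain ⟨a, ha, h⟩ := d.recMap_mem_range hab.isField_left hab.isField_right hab.le_normalizer w.2
    obtain ⟨x, rfl⟩ := exists_unitI_eq_of_mem_fixedBy (F := F) (E := E) ha
    exact ⟨x, (recSystemI_eq_weilRestrictE_iff hcf L' x w).mpr h⟩
  ker_eq L' _ _ := by
    set d := localWeilDatum F
    have hab := isAbelianPair_embField_of_finite F E L'
    ext x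
    rw [MonoidHom.mem_ker, ← unitI_mem_normGroup_iff (F := F) L' x,
      show (1 : L' ≃ₐ[E] L') = weilRestrictE F E L' 1 from (map_one _).symm,
      recSystemI_eq_weilRestrictE_iff,
      show ((1 : fieldSubgroup F (embField F E)) : WeilGroup F) = 1 from rfl,
      d.recMap_eq_one_of_mem hab.isField_left hab.isField_right hab.le hab.le_normalizer
        (fieldSubgroup F (embFieldOf F E L')).one_mem, eq_comm, QuotientGroup.eq_one_iff]
  compatible L' L'' _ _ _ _ hLL x γ hγ := by
    set d := localWeilDatum F
    have hab := isAbelianPair_embField_of_finite F E L'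
    have hab' := isAbelianPair_embField_of_finite F E L''
    haveI := d.finiteIndex hab.isField_right
    haveI := d.finiteIndex hab'.isField_right
    obtain ⟨w, hw⟩ := weilRestrictE_surjective F E L'' (recSystemI hcf L'' x)
    have hγ' : AlgEquiv.restrictNormalHom L'' (absoluteGaloisGroup.toAlgEquiv E γ) = weilRestrictE F E L'' w := by
      rw [hw]; exact hγ
    have h1 := (recSystemI_eq_weilRestrictE_iff hcf L'' x w).mp hw.symm
    have h2 : d.recMap (fieldSubgroup F (embField F E)) (fieldSubgroup F (embFieldOf F E L')) w =
        QuotientGroup.mk (unitI F E x) := by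
      rw [hcf.recMap_eq_map_recMap hab.isField_left hab.isField_right hab.le hab.le_normalizer
        hab'.isField_right hab'.le hab'.le_normalizer (fieldSubgroup_antitone F (embFieldOf_mono F E hLL)) w.2, h1]
      rfl
    rw [restrictNormalHom_eq_weilRestrictE_of_le hLL hγ']
    exact ((recSystemI_eq_weilRestrictE_iff hcf L' x w).mpr h2).symm
  map_unitGroup L' _ _ := by
    set d := localWeilDatum F
    have hab := isAbelianPair_embField_of_finite F E L'
    apply le_antisymm
    · rintro _ ⟨u, hu, rfl⟩
      have hu' : unitI F E u ∈ d.unitGroup (fieldSubgroup F (embField F E)) := (unitI_mem_unitGroup_iff u).mpr hu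
      obtain ⟨i, hi, hrec⟩ := hcf.exists_inertia_recMap_eq_of_unit hab hu'
      have hiU : i ∈ fieldSubgroup F (embField F E) := (Subgroup.mem_inf.mp hi).1
      refine ⟨liftGal F E ((toAbsGalois_mem_galFixing_iff (F := F)).mpr hiU),
        (liftGal_mem_absInertia_iff ⟨i, hiU⟩).mpr (Subgroup.mem_inf.mp hi).2, ?_⟩
      rw [restrictNormalHom_liftGal F E L' ⟨i, hiU⟩]
      exact ((recSystemI_eq_weilRestrictE_iff hcf L' u ⟨i, hiU⟩).mpr hrec).symm
    · rintro _ ⟨σ, hσ, rfl⟩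
      have hγI : absGaloisRestrict F E σ ∈ absInertia F := (absGaloisRestrict_mem_absInertia_iff F E σ).mpr hσ
      set i : WeilGroup F := WeilGroup.mk (absGaloisRestrict F E σ) ⟨0, isFrobPow_zero_iff_mem_absInertia.mpr hγI⟩
        with hi_def
      have hiγ : WeilGroup.toAbsGalois F i = absGaloisRestrict F E σ := by rw [hi_def, WeilGroup.toAbsGalois_mk]
      have hiU : i ∈ fieldSubgroup F (embField F E) := by
        rw [← toAbsGalois_mem_galFixing_iff, hiγ]
        exact absGaloisRestrict_mem_galFixing F E σ
      have hiI : i ∈ d.inertia := by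
        rw [(isLocalDatum_localWeilDatum F).mem_inertia_iff, hiγ]
        exact hγI
      obtain ⟨a, ha, hrec⟩ := hcf.exists_unit_recMap_eq_of_mem_inertia hab (Subgroup.mem_inf.mpr ⟨hiU, hiI⟩)
      obtain ⟨u, rfl⟩ := exists_unitI_eq_of_mem_fixedBy (F := F) (E := E) (d.unitGroup_le_fixedBy hab.isField_left ha)
      refine ⟨u, (unitI_mem_unitGroup_iff u).mp ha, ?_⟩
      rw [(recSystemI_eq_weilRestrictE_iff hcf L' u ⟨i, hiU⟩).mpr hrec, weilRestrictE_apply,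
        liftGal_eq_of_toAbsGalois_eq hiU hiγ]
      rfl
  unramified_uniformizer L' _ _ hL ϖ hϖ φ hφ := by
    set d := localWeilDatum F
    haveI := finiteDimensional_embSepField F E
    have hab := isAbelianPair_embField_of_finite F E L'
    have hU := hab.isField_left
    have hV := hab.isField_right
    have hKs := embSepField_le_sepClosure F E
    -- the pair `(U_E, V')` is unramified
    have hunr : d.IsUnramified (fieldSubgroup F (embFieldOf F E L')) (fieldSubgroup F (embField F E)) := by
      intro i hi
      have hiU : i ∈ fieldSubgroup F (embField F E) := (Subgroup.mem_inf.mp hi).1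
      have hiI := (liftGal_mem_absInertia_iff ⟨i, hiU⟩).mpr (Subgroup.mem_inf.mp hi).2
      apply (weilRestrictE_eq_one_iff F E L' ⟨i, hiU⟩).mp
      ext y
      rw [coe_weilRestrictE_apply, AlgEquiv.one_apply]
      exact hL _ hiI y
    -- the Frobenius `φ` of `E` restricts to an element of `U_E` of degree `f(E/F) = f_{U_E}`
    set f₀ := Ideal.inertiaDeg' 𝓂[F] (primeOf F (embSepField F E)) with hf₀
    have hqf : residueFieldCard E = residueFieldCard F ^ f₀ := residueFieldCard_eq_pow_inertiaDeg_sep F E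
    have hφ1 : IsFrobPow φ 1 := IsAbsArithFrob.isFrobPow_holds hφ
    have hφf : IsFrobPow (absGaloisRestrict F E φ) (f₀ : ℤ) := by
      have := IsFrobPow.absGaloisRestrict_holds F hφ1 f₀ hqf
      rwa [mul_one] at this
    set w : WeilGroup F := WeilGroup.mk (absGaloisRestrict F E φ) ⟨f₀, hφf⟩ with hw_def
    have hwγ : WeilGroup.toAbsGalois F w = absGaloisRestrict F E φ := by rw [hw_def, WeilGroup.toAbsGalois_mk]
    have hwU : w ∈ fieldSubgroup F (embField F E) := by
      rw [← toAbsGalois_mem_galFixing_iff, hwγ]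
      exact absGaloisRestrict_mem_galFixing F E φ
    have hdeg : d.degZ w = d.f (fieldSubgroup F (embField F E)) := by
      rw [degZ_localWeilDatum, show d.f (fieldSubgroup F (embField F E)) =
        AbstractCFT.inertiaDeg (degHom F) (fieldSubgroup F (embField F E)) from rfl,
        ← fieldSubgroup_embSepField_eq, inertiaDeg_fieldSubgroup_eq F (embSepField F E) hKs]
      exact (WeilGroup.deg_eq_iff IsFrobPow.mul_holds IsFrobPow.unique_holds).mpr (by rw [hwγ]; exact hφf)
    have hπ : unitI F E ϖ ∈ fixedBy (SepUnits F) (fieldSubgroup F (embField F E)) := unitI_mem F E ϖ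
    have hvπ : d.val (fieldSubgroup F (embField F E)) (unitI F E ϖ) = 1 := by
      rw [val_unitI]
      exact (ord_eq_one_iff E ϖ.ne_zero).mpr hϖ
    have hrec := hcf.recMap_frob_eq hU hV hab.le hunr hwU hdeg hπ hvπ
    rw [(recSystemI_eq_weilRestrictE_iff hcf L' ϖ ⟨w, hwU⟩).mpr hrec, weilRestrictE_apply,
      liftGal_eq_of_toAbsGalois_eq hwU hwγ]


/-! ### The theorem -/

omit [ValuativeRel F] [TopologicalSpace F] [IsNonarchimedeanLocalField F] [ValuativeRel E] [TopologicalSpace E]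
  [IsNonarchimedeanLocalField E] [FiniteDimensional F E] [ValuativeExtension F E] in
/-- `Gal(F̄/L)` is the kernel of the restriction `Γ_F → Gal(L/F)` for `L/F` normal. [folklore] -/
theorem galFixing_eq_ker_restrictNormalHom (L : IntermediateField F (AlgebraicClosure F)) [Normal F L] :
    galFixing F L = ((AlgEquiv.restrictNormalHom L).comp (absoluteGaloisGroup.toAlgEquiv F).toMonoidHom).ker := by
  ext σ
  rw [mem_galFixing_iff, MonoidHom.mem_ker, MonoidHom.comp_apply, MulEquiv.coe_toMonoidHom, AlgEquiv.ext_iff]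
  refine ⟨fun h y => Subtype.ext ?_, fun h y hy => ?_⟩
  · rw [AlgEquiv.restrictNormalHom_apply, AlgEquiv.one_apply, ← absoluteGaloisGroup.smul_def]
    exact h _ y.2
  · have := congrArg (fun z : L => (z : AlgebraicClosure F)) (h ⟨y, hy⟩)
    rw [AlgEquiv.restrictNormalHom_apply, AlgEquiv.one_apply, ← absoluteGaloisGroup.smul_def] at this
    exact this

variable (F E) in
/-- **Norm functoriality of the reciprocity map (Serre XIII §4 Prop. 10) at finite level for an
arbitrary finite `E/F`, from the class field axiom for the Weil datum of `F`**: the reciprocity systems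
`ω^F` (`localRecSystem`) and `ω^E` (`recSystemI`) satisfy the pair fact
`exists_isReciprocitySystem_normCompatible F E`.  Given a finite abelian `L/F`, a finite abelian
`L''/E` with `Gal(Ē/L'') = res⁻¹(Gal(F̄/L))` exists (`exists_isAbelianGalois_fixingSubgroup_eq`), so that
`W_F ∩ G_{ι⁻¹L''} ≤ W_F ∩ G_L`; a representative `γ` of `θ_E(x)` restricts on `L''` to `ν|_{L''}` with
`r_{U_E, V''}(ν) ≡ (ι⁻¹x)^q`; by (5.8) `r_{W_F, W_F ∩ G_L}(ν) ≡ N_{U_E|W_F}((ι⁻¹x)^q) = N_{E/F} x`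
(`norm_powEmb`), so `ν|_L = (N_{E/F} x, L/F)` and `ν|_L = (res γ)|_L`.
[cite: SerreLocalFields1979, Ch. XIII §4 Prop. 10; NeukirchANT1999, Ch. IV §5 (5.8), §6 (6.4)–(6.6)] -/
theorem exists_isReciprocitySystem_normCompatible_of_isClassFieldTheory (hcf : (localWeilDatum F).IsClassFieldTheory) :
    exists_isReciprocitySystem_normCompatible F E := by
  set d := localWeilDatum F
  have hd := isLocalDatum_localWeilDatum F
  haveI := finiteDimensional_embSepField F E
  have hKs := embSepField_le_sepClosure F E
  have hωE := isReciprocitySystemI (F := F) (E := E) hcf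
  refine ⟨localRecSystem F hcf, recSystemI hcf, isReciprocitySystem hd hcf, hωE, fun x => ?_⟩
  obtain ⟨γ, hγ⟩ := hωE.reps_nonempty x
  refine ⟨γ, fun L' _ _ => (IsReciprocitySystem.mem_reps_iff hωE).mp hγ L', fun L _ _ => ?_⟩
  -- a finite abelian `L''/E` with `Gal(Ē/L'') = res⁻¹(Gal(F̄/L))`
  let Ures : Subgroup (absoluteGaloisGroup E) := (galFixing F L).comap (absGaloisRestrict F E).toMonoidHom
  haveI : (galFixing F L).Normal := by
    rw [galFixing_eq_ker_restrictNormalHom]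
    exact MonoidHom.normal_ker _
  haveI : Ures.Normal := Subgroup.Normal.comap inferInstance _
  have hUopen : IsOpen (Ures : Set (absoluteGaloisGroup E)) :=
    (isOpen_galFixing F L).preimage (absGaloisRestrict F E).continuous
  have hcomm : ∀ a b : absoluteGaloisGroup E, a * b * a⁻¹ * b⁻¹ ∈ Ures := by
    intro a b
    change absGaloisRestrict F E (a * b * a⁻¹ * b⁻¹) ∈ galFixing F L
    rw [galFixing_eq_ker_restrictNormalHom, MonoidHom.mem_ker, map_mul, map_mul, map_mul, map_inv, map_inv,
      map_mul, map_mul, map_mul, map_inv, map_inv,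
      IsMulCommutative.is_comm.comm
        (((AlgEquiv.restrictNormalHom L).comp (absoluteGaloisGroup.toAlgEquiv F).toMonoidHom) (absGaloisRestrict F E a))
        (((AlgEquiv.restrictNormalHom L).comp (absoluteGaloisGroup.toAlgEquiv F).toMonoidHom) (absGaloisRestrict F E b)),
      mul_inv_cancel_right, mul_inv_cancel]
  obtain ⟨L'', hfin, habel, hfix⟩ := absoluteGaloisGroup.exists_isAbelianGalois_fixingSubgroup_eq E Ures hUopen hcomm
  haveI := hfin
  haveI := habel
  have hab := hd.isAbelianPair_top L
  have habE := isAbelianPair_embField_of_finite F E L''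
  -- `W_F ∩ G_{ι⁻¹L''} ≤ W_F ∩ G_L`
  have hV'V : fieldSubgroup F (embFieldOf F E L'') ≤ fieldSubgroup F L := by
    intro w' hw'
    have hw'U : w' ∈ fieldSubgroup F (embField F E) := fieldSubgroup_antitone F (embField_le_embFieldOf F E L'') hw'
    have h1 := (weilRestrictE_eq_one_iff F E L'' ⟨w', hw'U⟩).mpr hw'
    rw [weilRestrictE_apply] at h1
    have h2 : absoluteGaloisGroup.toAlgEquiv E (liftGal F E ((toAbsGalois_mem_galFixing_iff (F := F)).mpr hw'U)) ∈
        (AlgEquiv.restrictNormalHom L'').ker := h1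
    rw [IntermediateField.restrictNormalHom_ker, hfix] at h2
    have h3 : absGaloisRestrict F E (liftGal F E ((toAbsGalois_mem_galFixing_iff (F := F)).mpr hw'U)) ∈ galFixing F L := h2
    rw [absGaloisRestrict_liftGal] at h3
    exact (toAbsGalois_mem_galFixing_iff (F := F)).mp h3
  -- `γ|_{L''} = (x, L''/E) = w|_{L''}` with `r_{U_E, V''}(w) ≡ (ι⁻¹ x)^q`
  obtain ⟨w, hw⟩ := weilRestrictE_surjective F E L'' (recSystemI hcf L'' x)
  have hγ'' : AlgEquiv.restrictNormalHom L'' (absoluteGaloisGroup.toAlgEquiv E γ) = recSystemI hcf L'' x :=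
    (IsReciprocitySystem.mem_reps_iff hωE).mp hγ L''
  have h1 := (recSystemI_eq_weilRestrictE_iff hcf L'' x w).mp hw.symm
  -- (5.8): `r_{W_F, W_F ∩ G_L}(w) ≡ N_{U_E|W_F}((ι⁻¹ x)^q)`
  have h2 := hcf.recMap_eq_mk_norm_of_recMap_eq d.isField_top hab.isField_right hab.le hab.le_normalizer
    habE.isField_left habE.isField_right habE.le habE.le_normalizer le_top hV'V w.2 h1
  -- `N_{U_E|W_F}((ι⁻¹ x)^q) = N_{E/F} x`
  have haK := coe_unitI_mem F E x
  have h3 : norm (fieldSubgroup F (embField F E)) ⊤ (unitI F E x) = unitOf F (Units.map (Algebra.norm F : E →* F) x) := by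
    apply Units.ext
    apply Subtype.ext
    rw [← fieldSubgroup_embSepField_eq, norm_fieldSubgroup_top_eq_algebraMap F (embSepField F E) hKs haK, coe_unitOf,
      show (⟨_, haK⟩ : embSepField F E) = powEmb F E (equivEmbField F E (x : E)) from rfl, norm_powEmb,
      Algebra.norm_eq_of_algEquiv]
    rfl
  rw [h3] at h2
  have h4 : localRecSystem F hcf L (Units.map (Algebra.norm F : E →* F) x) = weilRestrict F L w :=
    (recSystem_eq_weilRestrict_iff hd hcf L _ w).mpr h2
  rw [h4]
  -- `(res γ)|_L = w|_L`: `γ⁻¹ · lift(w)` fixes `L''` pointwise, so lies in `res⁻¹(Gal(F̄/L))`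
  have hagree : AlgEquiv.restrictNormalHom L'' (absoluteGaloisGroup.toAlgEquiv E γ) = weilRestrictE F E L'' w := by
    rw [hγ'', hw]
  have hmemU : γ⁻¹ * liftGal F E ((toAbsGalois_mem_galFixing_iff (F := F)).mpr w.2) ∈ Ures := by
    rw [← hfix]
    refine (IntermediateField.mem_fixingSubgroup_iff L''
      (γ⁻¹ * liftGal F E ((toAbsGalois_mem_galFixing_iff (F := F)).mpr w.2))).mpr fun z hz => ?_
    have := congrArg (fun g : L'' ≃ₐ[E] L'' => ((g ⟨z, hz⟩ : L'') : AlgebraicClosure E)) hagree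
    simp only [AlgEquiv.restrictNormalHom_apply, coe_weilRestrictE_apply] at this
    rw [absoluteGaloisGroup.smul_def] at this
    show (absoluteGaloisGroup.toAlgEquiv E (γ⁻¹ * liftGal F E ((toAbsGalois_mem_galFixing_iff (F := F)).mpr w.2))) z = z
    rw [map_mul, map_inv, AlgEquiv.mul_apply, ← this, AlgEquiv.aut_inv, AlgEquiv.symm_apply_apply]
  have hfixL : (absGaloisRestrict F E γ)⁻¹ * WeilGroup.toAbsGalois F (w : WeilGroup F) ∈ galFixing F L := by
    have h5 : absGaloisRestrict F E (γ⁻¹ * liftGal F E ((toAbsGalois_mem_galFixing_iff (F := F)).mpr w.2)) ∈ galFixing F L :=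
      Subgroup.mem_comap.mp hmemU
    rwa [map_mul, map_inv, absGaloisRestrict_liftGal] at h5
  ext y
  rw [AlgEquiv.restrictNormalHom_apply, coe_weilRestrict_apply, ← absoluteGaloisGroup.smul_def]
  have h6 := (mem_galFixing_iff F).mp hfixL y y.2
  rw [mul_smul, inv_smul_eq_iff] at h6
  exact h6.symm

end PairILocal

/-! ### Consequences: the unconditional discharges -/

section Holds

universe u v

variable (F : Type u) [Field F] [ValuativeRel F] [TopologicalSpace F] [IsNonarchimedeanLocalField F]

/-- **Discharge of `exists_isReciprocitySystem_normCompatible F E`** (Serre XIII §4 Prop. 10 at finite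
level) for every finite extension `E/F` of non-archimedean local fields.
[cite: SerreLocalFields1979, Ch. XIII §4 Prop. 10; NeukirchANT1999, Ch. V §1, Thm. (1.4)] -/
theorem exists_isReciprocitySystem_normCompatible_holds
    (E : Type v) [Field E] [ValuativeRel E] [TopologicalSpace E] [IsNonarchimedeanLocalField E]
    [Algebra F E] [FiniteDimensional F E] [ValuativeExtension F E] :
    exists_isReciprocitySystem_normCompatible F E :=
  exists_isReciprocitySystem_normCompatible_of_isClassFieldTheory F E (isClassFieldTheory_localWeilDatum F)

/-- **Discharge of `exists_isLocalReciprocityMap_normCompatible F E`** (Serre XIII §4 Thm. 1 with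
Prop. 10: reciprocity maps `θ_F`, `θ_E` with `θ_F ∘ N_{E/F} = res ∘ θ_E`) for every finite `E/F`.
[cite: SerreLocalFields1979, Ch. XIII §4 Thm. 1, Prop. 10] -/
theorem exists_isLocalReciprocityMap_normCompatible_holds
    (E : Type v) [Field E] [ValuativeRel E] [TopologicalSpace E] [IsNonarchimedeanLocalField E]
    [Algebra F E] [FiniteDimensional F E] [ValuativeExtension F E] :
    exists_isLocalReciprocityMap_normCompatible F E :=
  exists_isLocalReciprocityMap_normCompatible_of_isReciprocitySystem
    (exists_isReciprocitySystem_normCompatible_holds F E)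
    (universalNormSubgroup_eq_bot F) (universalNormSubgroup_eq_bot E)

/-- **Discharge of `exists_isCompatible F`** (`LocalClassFieldTheory.lean`; Serre, *Local Fields*,
Ch. XIII §4 Prop. 10): for every finite extension `E/F` of non-archimedean local fields there are
local Artin data of `F` and `E` compatible with the norm, `Art_F ∘ (W_E → W_F) = N_{E/F} ∘ Art_E`.
Neukirch's cohomology-free class field theory for the Weil datum of `F` (`localWeilDatum`, class
field axiom V (1.1) = `cyclicNormIndexEq_holds`, reciprocity law IV (6.3)), norm functoriality IV
(5.8) read for `E` inside that datum (through the relative Frobenius when `E/F` is inseparable), and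
the vanishing of universal norms (`universalNormSubgroup_eq_bot`, Lubin–Tate) to pass to `θ`.
[cite: SerreLocalFields1979, Ch. XIII §4 Prop. 10; NeukirchANT1999, Ch. IV §6 (6.3), Ch. V §1 (1.1), (1.4)] -/
theorem exists_isCompatible_holds : exists_isCompatible.{u, v} F :=
  exists_isCompatible_of_exists_isReciprocitySystem_normCompatible fun E _ _ _ _ _ _ _ =>
    exists_isReciprocitySystem_normCompatible_holds F E

end Holds

end LocalWeilDatum

/-! ### The named fact of `LocalClassFieldTheory.lean`, discharged under its own name -/

section Target

universe u v

/-- **`exists_isCompatible` holds** (Serre, *Local Fields*, Ch. XIII §4 Prop. 10: for every finite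
extension `E/F` of non-archimedean local fields, local Artin data of `F` and of `E` compatible with
the norm map).  This is `LocalWeilDatum.exists_isCompatible_holds`, restated at the fact's own
namespace. [cite: SerreLocalFields1979, Ch. XIII §4 Prop. 10] -/
theorem exists_isCompatible_holds (F : Type u) [Field F] [ValuativeRel F] [TopologicalSpace F]
    [IsNonarchimedeanLocalField F] : exists_isCompatible.{u, v} F :=
  LocalWeilDatum.exists_isCompatible_holds F

end Target

end Literature.NumberTheory.GaloisRepresentations
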